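import Literature.NumberTheory.EllipticCurves.SurjectiveModPFrobeniusSupplyProofs
import Literature.NumberTheory.EllipticCurves.ExceptionalPrimesDensityModels
import Literature.NumberTheory.EllipticCurves.GlobalMinimalModelProofs
import Literature.NumberTheory.EllipticCurves.IsogenyVariableChangeProofs
import Literature.NumberTheory.EllipticCurves.ComplexMultiplicationLFunctionIsogenyHoldsProofs
import Literature.NumberTheory.EllipticCurves.LFunctionPrimeCoeff
import HarnessLib

/-!
# (CHEB) Chebotarev supply at `3` for the inert-Hecke certificate — PROVED for every model

Support file for crux `CartanOnePlaceDegreeLawAtThree` (NUM; item stmt-BirchSwinnertonDyer-24801, line `lattice` v8 ∕ `charext` v13),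
Galois leaf (OBS) `CartanCover.Charext.NoModThreePeriodCharacterExtension`. The certificate's print input (CHEB)
(`CartanCover.Charext.InertHecke.ChebotarevSupplyAtThree`, typed by cruxidea-24801-1 g0; part C, p741333) reads:
«if `ρ̄_{W,3}` is onto then, outside any finite set of primes, there is a prime `ℓ ≡ 2 (mod 3)` with `3 ∤ a_ℓ(W)`,
`a_ℓ(W) = W.LFunction ℓ`» — for EVERY elliptic Weierstrass model `W/ℚ` (not only globally minimal ones).

The tree already proves the globally-minimal, `frobeniusTrace` form
(`Literature.NumberTheory.EllipticCurves.exists_goodPrime_mod_three_eq_two_not_dvd_frobeniusTrace_of_surj`: Chebotarev in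
`ℚ(E[3])` at the class `(tr, det) = (1, −1)` of `GL₂(𝔽₃)`, Serre's (238), DDT 2.8 (a)). This file transports it to an arbitrary
model: pass to a global minimal model `C • W` (`hasGlobalMinimalModel_rat_holds`, Silverman VIII.8.3), move surjectivity along the
change of variables (`hasSurjectiveModNGaloisRep_smul_iff`), read `a_ℓ` as the `L`-series coefficient at the good prime `ℓ`
(`LFunction_apply_prime_eq_frobeniusTrace`) and come back by isogeny invariance of the `L`-function (`LFunction_eq_of_isIsogenous_holds`,
Knapp 11.67, with `isIsogenous_smul`). Nothing here is specific to a curve of the census; BSD is proved for no curve.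
-/

set_option linter.dupNamespace false
set_option autoImplicit false

noncomputable section

open scoped Classical

namespace Summit.BirchSwinnertonDyer.BirchSwinnertonDyer.Theorems.CartanCover.Charext.InertHecke

open Literature.NumberTheory.EllipticCurves WeierstrassCurve

/-- **(CHEB) for every model.** Let `W/ℚ` be an elliptic curve (any Weierstrass model) with `ρ̄_{W,3} : Γ_ℚ → Aut(W[3])` onto and `S` a
finite set of naturals. Then there is a prime `ℓ ∉ S` with `ℓ ≡ 2 (mod 3)` and `3 ∤ a_ℓ(W)`, where `a_ℓ(W) = W.LFunction ℓ` is the `ℓ`-th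
coefficient of `L(W, s)`; moreover `ℓ ≠ 3` and `ℓ` is a prime of good reduction of the global minimal model. Proof: module docstring
(Chebotarev in `ℚ(E[3])` at the class of `(0 1; 1 1)`, transported along a global minimal model).
[cite: TateGCFT1967, §2.4 (Tchebotarev density theorem)] [cite: Serre1981, §8.1 eq. (238) (p. 188)]
[cite: DarmonDiamondTaylor1995, Prop. 2.8 (a)] [cite: SilvermanAEC2009, VIII.8, Cor. 8.3, p. 213] [cite: Knapp1993, Thm. 11.67] -/
theorem exists_prime_mod_three_eq_two_not_three_dvd_lFunction_of_surj (W : WeierstrassCurve ℚ) [W.IsElliptic]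
    (hsurj : W.HasSurjectiveModNGaloisRep 3) (S : Set ℕ) (hS : S.Finite) :
    ∃ ℓ : ℕ, ℓ.Prime ∧ ℓ ∉ S ∧ ℓ ≠ 3 ∧ ℓ % 3 = 2 ∧ ¬ (3 : ℤ) ∣ W.LFunction ℓ := by
  haveI : Fact (3 : ℕ).Prime := ⟨Nat.prime_three⟩
  -- a global minimal model `C • W`
  obtain ⟨C, hC⟩ := hasGlobalMinimalModel_rat_holds W
  haveI := hC
  have hsurj' : (C • W).HasSurjectiveModNGaloisRep 3 :=
    (hasSurjectiveModNGaloisRep_smul_iff W C 3).mpr hsurj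
  obtain ⟨ℓ, hℓ, hℓS, hℓ3, hℓΔ, hmod, htr⟩ :=
    exists_goodPrime_mod_three_eq_two_not_dvd_frobeniusTrace_of_surj (C • W) hsurj' S hS
  haveI : Fact ℓ.Prime := ⟨hℓ⟩
  refine ⟨ℓ, hℓ, hℓS, hℓ3, hmod, ?_⟩
  rw [LFunction_eq_of_isIsogenous_holds W (C • W) (isIsogenous_smul W C),
    LFunction_apply_prime_eq_frobeniusTrace (C • W) ℓ (hasGoodReductionAtPrime_of_not_dvd (C • W) ℓ hℓΔ)]
  exact htr

/-- **(CHEB) in the certificate's literal shape** (`ChebotarevSupplyAtThree` of part C, unfolded): surjective `ρ̄_{W,3}` ⟹ for every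
finite `S` a prime `ℓ ∉ S`, `ℓ ≡ 2 (mod 3)`, `3 ∤ W.LFunction ℓ`. [cite: Serre1981, §8.1 eq. (238) (p. 188)]
[cite: DarmonDiamondTaylor1995, Prop. 2.8 (a)] -/
theorem chebotarevSupplyAtThree_unfolded :
    ∀ (W : WeierstrassCurve ℚ) [W.IsElliptic], W.HasSurjectiveModNGaloisRep 3 → ∀ S : Set ℕ, S.Finite →
      ∃ ℓ : ℕ, ℓ.Prime ∧ ℓ ∉ S ∧ ℓ % 3 = 2 ∧ ¬ (3 : ℤ) ∣ W.LFunction ℓ := by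
  intro W _ hsurj S hS
  obtain ⟨ℓ, hℓ, hℓS, -, hmod, htr⟩ := exists_prime_mod_three_eq_two_not_three_dvd_lFunction_of_surj W hsurj S hS
  exact ⟨ℓ, hℓ, hℓS, hmod, htr⟩

end Summit.BirchSwinnertonDyer.BirchSwinnertonDyer.Theorems.CartanCover.Charext.InertHecke

end
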